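import Summits.ValiantsHypothesis.ValiantsHypothesis.Theorems.BarrierLeverPriorityPeelingCertificatesExistOfDerivations
import Summits.ValiantsHypothesis.ValiantsHypothesis.Theorems.BarrierLeverPriorityPeelingLayoutsSmallRank
import Summits.ValiantsHypothesis.ValiantsHypothesis.Theorems.BarrierLeverPriorityPeelingLayoutsTwoCerts

/-!
# Route BarrierLever — priority peeling for TT: EVERY layout with `h ≤ 2` is PP-derivable

Helper file (`--supports stmt-ValiantsHypothesis-19761`; cell valiant-natproofs, rung V4, 𝒟-side door
(c); prover val-np-p1 g7; the planner's «first rung h ≤ 2» of item 19761, HOME/STATUS l.451 (1)(a)).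
Closes NO item.

Item 19761 `PriorityPeelingCertificatesExist` (the residual conjecture of record for TT, item 19152)
says that every injective transversal layout `(u, w)`, `u w : Fin r → Finset (Fin h)`, lies in every
predicate closed under the priority-peeling clauses; by the bridge `PPBridge.closed_of_ppDerivable`
(p467389) it suffices that the layout's configuration has a derivation `PriorityPeeling.PPDerivable`
(p460060). Here we prove this for ALL layouts with `h ≤ 2` (every `r`):

* `ppDerivable_layout_h2`: `h = 2`. An injective `u : Fin r → Finset (Fin 2)` is, after re-indexing
  (`PPSmall.ppDerivable_of_perm`, sibling file `…LayoutsSmallRank`), the increasing enumeration of its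
  image read through the code table `![∅, {0}, {1}, {0, 1}]` (`eq_table_code`, `codes3_cases`,
  `codes4_cases` — the case lists are decided on `Fin 4` codes); `r ≤ 2` is the generic small-rank
  case, the `4 × 4 = 16` canonical pairs with `r = 3` and the one with `r = 4` are the machine-emitted
  kernel certificates of `…LayoutsTwoCerts` (HOME/prover/gen7/pp_emit.py); `r ≥ 5` is impossible.
* `ppDerivable_layout_of_le_two` (all `h ≤ 2`, all `r`; `h ≤ 1` from `…LayoutsSmallRank`), and the two
  slices it yields: `priorityPeelingCertificates_of_le_two` = item 19761's statement (route file,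
  verbatim) with the extra hypothesis `h ≤ 2` (via the bridge), and
  `transversalMinorLayouts_nonsingular_of_le_two` = item 19152's (TT) conclusion for `h ≤ 2` (via
  `alive_of_ppDerivable`).

WHAT THIS IS NOT: a finite slice (a witness that 19761's clause set is adequate through `h = 2`);
nothing on 19761 / TT for general `h`, on crux stmt-ValiantsHypothesis-14610, or on VP versus VNP.
-/

-- layout Summits/ValiantsHypothesis/ValiantsHypothesis forces the duplicated namespace component
set_option linter.dupNamespace false

namespace Summit.ValiantsHypothesis.ValiantsHypothesis.Theorems.BarrierLever.PPSmall

open Summit.ValiantsHypothesis.ValiantsHypothesis.Theorems.BarrierLever.PriorityPeeling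

/-! ## 4. `h = 2`: codes and canonical forms -/

/-- Every subset of `Fin 2` is the table entry of its code. -/
theorem eq_table_code (s : Finset (Fin 2)) :
    s = (![∅, {0}, {1}, {0, 1}] : Fin 4 → Finset (Fin 2))
      (if (0 : Fin 2) ∈ s then (if (1 : Fin 2) ∈ s then 3 else 1)
        else (if (1 : Fin 2) ∈ s then 2 else 0)) := by
  by_cases h0 : (0 : Fin 2) ∈ s <;> by_cases h1 : (1 : Fin 2) ∈ s <;>
    simp only [h0, h1, if_true, if_false] <;> ext a <;> fin_cases a <;> simp [h0, h1]

/-- Canonical forms of injective triples of codes (decided): the image is one of the four 3-subsets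
of `Fin 4`, enumerated increasingly. -/
theorem codes3_cases : ∀ c₀ c₁ c₂ : Fin 4, c₀ ≠ c₁ → c₀ ≠ c₂ → c₁ ≠ c₂ →
    (∀ i : Fin 3, ∃ j : Fin 3, (![c₀, c₁, c₂] : Fin 3 → Fin 4) i = (![1, 2, 3] : Fin 3 → Fin 4) j) ∨
    (∀ i : Fin 3, ∃ j : Fin 3, (![c₀, c₁, c₂] : Fin 3 → Fin 4) i = (![0, 2, 3] : Fin 3 → Fin 4) j) ∨
    (∀ i : Fin 3, ∃ j : Fin 3, (![c₀, c₁, c₂] : Fin 3 → Fin 4) i = (![0, 1, 3] : Fin 3 → Fin 4) j) ∨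
    (∀ i : Fin 3, ∃ j : Fin 3, (![c₀, c₁, c₂] : Fin 3 → Fin 4) i = (![0, 1, 2] : Fin 3 → Fin 4) j) := by
  decide

/-- Canonical form of injective quadruples of codes (decided): every code occurs. -/
theorem codes4_cases : ∀ c₀ c₁ c₂ c₃ : Fin 4, c₀ ≠ c₁ → c₀ ≠ c₂ → c₀ ≠ c₃ → c₁ ≠ c₂ → c₁ ≠ c₃ →
    c₂ ≠ c₃ →
    ∀ i : Fin 4, ∃ j : Fin 4, (![c₀, c₁, c₂, c₃] : Fin 4 → Fin 4) i = (![0, 1, 2, 3] : Fin 4 → Fin 4) j := by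
  decide

/-- From codes to layouts: if the codes of `u` are among the values of `v` and the codes of `w` among
those of `v'` (`u`, `w` injective), a certificate for the canonical pair `(v, v')` gives a derivation
for `(u, w)`. -/
theorem ppDerivable_h2_of_codes {r : ℕ} (u w : Fin r → Finset (Fin 2)) (hu : Function.Injective u)
    (hw : Function.Injective w) (v v' : Fin r → Fin 4)
    (hv : ∀ i, ∃ j, (if (0 : Fin 2) ∈ u i then (if (1 : Fin 2) ∈ u i then (3 : Fin 4) else 1)
        else (if (1 : Fin 2) ∈ u i then 2 else 0)) = v j)
    (hv' : ∀ i, ∃ j, (if (0 : Fin 2) ∈ w i then (if (1 : Fin 2) ∈ w i then (3 : Fin 4) else 1)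
        else (if (1 : Fin 2) ∈ w i then 2 else 0)) = v' j)
    (cert : PPDerivable 4 4 (Fin r) 2
      (fun i a => if a ∈ (![∅, {0}, {1}, {0, 1}] : Fin 4 → Finset (Fin 2)) (v i)
        then Fin.castAdd 2 a else Fin.natAdd 2 a)
      (fun j c => if c ∈ (![∅, {0}, {1}, {0, 1}] : Fin 4 → Finset (Fin 2)) (v' j)
        then Fin.natAdd 2 c else Fin.castAdd 2 c)) :
    PPDerivable (2 + 2) (2 + 2) (Fin r) 2
      (fun i a => if a ∈ u i then Fin.castAdd 2 a else Fin.natAdd 2 a)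
      (fun j c => if c ∈ w j then Fin.natAdd 2 c else Fin.castAdd 2 c) := by
  have hcu : ∀ i, u i = (![∅, {0}, {1}, {0, 1}] : Fin 4 → Finset (Fin 2))
      (if (0 : Fin 2) ∈ u i then (if (1 : Fin 2) ∈ u i then (3 : Fin 4) else 1)
        else (if (1 : Fin 2) ∈ u i then 2 else 0)) := fun i => eq_table_code (u i)
  have hcw : ∀ i, w i = (![∅, {0}, {1}, {0, 1}] : Fin 4 → Finset (Fin 2))
      (if (0 : Fin 2) ∈ w i then (if (1 : Fin 2) ∈ w i then (3 : Fin 4) else 1)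
        else (if (1 : Fin 2) ∈ w i then 2 else 0)) := fun i => eq_table_code (w i)
  have hinj : Function.Injective (fun i => (if (0 : Fin 2) ∈ u i then
      (if (1 : Fin 2) ∈ u i then (3 : Fin 4) else 1) else (if (1 : Fin 2) ∈ u i then 2 else 0))) :=
    fun i j hij => hu (by rw [hcu i, hcu j]; exact congrArg _ hij)
  have hinj' : Function.Injective (fun i => (if (0 : Fin 2) ∈ w i then
      (if (1 : Fin 2) ∈ w i then (3 : Fin 4) else 1) else (if (1 : Fin 2) ∈ w i then 2 else 0))) :=
    fun i j hij => hw (by rw [hcw i, hcw j]; exact congrArg _ hij)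
  obtain ⟨σ, hσ⟩ := exists_perm_of_forall_exists hv hinj
  obtain ⟨τ, hτ⟩ := exists_perm_of_forall_exists hv' hinj'
  refine ppDerivable_of_perm _ _ _ _ σ τ (fun i => ?_) (fun j => ?_) cert
  · funext a
    rw [hcu i, hσ i]
  · funext c
    rw [hcw j, hτ j]

/-- **`h = 2`, every `r`.** -/
theorem ppDerivable_layout_h2 (r : ℕ) (u w : Fin r → Finset (Fin 2)) (hu : Function.Injective u)
    (hw : Function.Injective w) :
    PPDerivable (2 + 2) (2 + 2) (Fin r) 2
      (fun i a => if a ∈ u i then Fin.castAdd 2 a else Fin.natAdd 2 a)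
      (fun j c => if c ∈ w j then Fin.natAdd 2 c else Fin.castAdd 2 c) := by
  -- the code maps and their injectivity
  have hcu : ∀ i, u i = (![∅, {0}, {1}, {0, 1}] : Fin 4 → Finset (Fin 2))
      (if (0 : Fin 2) ∈ u i then (if (1 : Fin 2) ∈ u i then (3 : Fin 4) else 1)
        else (if (1 : Fin 2) ∈ u i then 2 else 0)) := fun i => eq_table_code (u i)
  have hcw : ∀ i, w i = (![∅, {0}, {1}, {0, 1}] : Fin 4 → Finset (Fin 2))
      (if (0 : Fin 2) ∈ w i then (if (1 : Fin 2) ∈ w i then (3 : Fin 4) else 1)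
        else (if (1 : Fin 2) ∈ w i then 2 else 0)) := fun i => eq_table_code (w i)
  set cu : Fin r → Fin 4 := fun i => (if (0 : Fin 2) ∈ u i then
      (if (1 : Fin 2) ∈ u i then (3 : Fin 4) else 1) else (if (1 : Fin 2) ∈ u i then 2 else 0))
    with hcu_def
  set cw : Fin r → Fin 4 := fun i => (if (0 : Fin 2) ∈ w i then
      (if (1 : Fin 2) ∈ w i then (3 : Fin 4) else 1) else (if (1 : Fin 2) ∈ w i then 2 else 0))
    with hcw_def
  have hinj : Function.Injective cu :=
    fun i j hij => hu (by rw [hcu i, hcu j]; exact congrArg _ hij)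
  have hinj' : Function.Injective cw :=
    fun i j hij => hw (by rw [hcw i, hcw j]; exact congrArg _ hij)
  rcases r with _ | _ | _ | _ | _ | r
  · exact ppDerivable_layout_r0 2 u w
  · exact ppDerivable_layout_r1 2 u w
  · exact ppDerivable_layout_r2 2 u w hu hw
  · -- r = 3 : sixteen canonical pairs
    have eu : ∀ i : Fin 3, (![cu 0, cu 1, cu 2] : Fin 3 → Fin 4) i = cu i := by
      intro i; fin_cases i <;> rfl
    have ew : ∀ i : Fin 3, (![cw 0, cw 1, cw 2] : Fin 3 → Fin 4) i = cw i := by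
      intro i; fin_cases i <;> rfl
    have Hu := codes3_cases (cu 0) (cu 1) (cu 2) (hinj.ne (by decide)) (hinj.ne (by decide))
      (hinj.ne (by decide))
    have Hw := codes3_cases (cw 0) (cw 1) (cw 2) (hinj'.ne (by decide)) (hinj'.ne (by decide))
      (hinj'.ne (by decide))
    simp only [eu, ew] at Hu Hw
    rcases Hu with hv | hv | hv | hv <;> rcases Hw with hv' | hv' | hv' | hv'
    · exact ppDerivable_h2_of_codes u w hu hw _ _ hv hv' cert_h2_r3_123_123
    · exact ppDerivable_h2_of_codes u w hu hw _ _ hv hv' cert_h2_r3_123_023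
    · exact ppDerivable_h2_of_codes u w hu hw _ _ hv hv' cert_h2_r3_123_013
    · exact ppDerivable_h2_of_codes u w hu hw _ _ hv hv' cert_h2_r3_123_012
    · exact ppDerivable_h2_of_codes u w hu hw _ _ hv hv' cert_h2_r3_023_123
    · exact ppDerivable_h2_of_codes u w hu hw _ _ hv hv' cert_h2_r3_023_023
    · exact ppDerivable_h2_of_codes u w hu hw _ _ hv hv' cert_h2_r3_023_013
    · exact ppDerivable_h2_of_codes u w hu hw _ _ hv hv' cert_h2_r3_023_012
    · exact ppDerivable_h2_of_codes u w hu hw _ _ hv hv' cert_h2_r3_013_123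
    · exact ppDerivable_h2_of_codes u w hu hw _ _ hv hv' cert_h2_r3_013_023
    · exact ppDerivable_h2_of_codes u w hu hw _ _ hv hv' cert_h2_r3_013_013
    · exact ppDerivable_h2_of_codes u w hu hw _ _ hv hv' cert_h2_r3_013_012
    · exact ppDerivable_h2_of_codes u w hu hw _ _ hv hv' cert_h2_r3_012_123
    · exact ppDerivable_h2_of_codes u w hu hw _ _ hv hv' cert_h2_r3_012_023
    · exact ppDerivable_h2_of_codes u w hu hw _ _ hv hv' cert_h2_r3_012_013
    · exact ppDerivable_h2_of_codes u w hu hw _ _ hv hv' cert_h2_r3_012_012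
  · -- r = 4 : one canonical pair
    have eu : ∀ i : Fin 4, (![cu 0, cu 1, cu 2, cu 3] : Fin 4 → Fin 4) i = cu i := by
      intro i; fin_cases i <;> rfl
    have ew : ∀ i : Fin 4, (![cw 0, cw 1, cw 2, cw 3] : Fin 4 → Fin 4) i = cw i := by
      intro i; fin_cases i <;> rfl
    have hv := codes4_cases (cu 0) (cu 1) (cu 2) (cu 3) (hinj.ne (by decide)) (hinj.ne (by decide))
      (hinj.ne (by decide)) (hinj.ne (by decide)) (hinj.ne (by decide)) (hinj.ne (by decide))
    have hv' := codes4_cases (cw 0) (cw 1) (cw 2) (cw 3) (hinj'.ne (by decide))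
      (hinj'.ne (by decide)) (hinj'.ne (by decide)) (hinj'.ne (by decide)) (hinj'.ne (by decide))
      (hinj'.ne (by decide))
    simp only [eu, ew] at hv hv'
    exact ppDerivable_h2_of_codes u w hu hw _ _ hv hv' cert_h2_r4_0123_0123
  · -- r ≥ 5 : impossible
    exfalso
    have h1 := Fintype.card_le_of_injective cu hinj
    simp only [Fintype.card_fin] at h1
    omega

/-! ## 5. All layouts with `h ≤ 2`; the slices of items 19761 and 19152 -/

/-- **Every injective TT layout with `h ≤ 2` has a priority-peeling derivation.** -/
theorem ppDerivable_layout_of_le_two (h r : ℕ) (hh : h ≤ 2) (u w : Fin r → Finset (Fin h))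
    (hu : Function.Injective u) (hw : Function.Injective w) :
    PPDerivable (h + h) (h + h) (Fin r) h
      (fun i a => if a ∈ u i then Fin.castAdd h a else Fin.natAdd h a)
      (fun j c => if c ∈ w j then Fin.natAdd h c else Fin.castAdd h c) := by
  interval_cases h
  · exact ppDerivable_layout_h0 r u w hu
  · exact ppDerivable_layout_h1 r u w hu hw
  · exact ppDerivable_layout_h2 r u w hu hw

/-- **The `h ≤ 2` slice of TT** (item 19152 `TransversalMinorLayoutsNonsingular`, its conclusion
verbatim): every injective layout with `h ≤ 2` has a nonsingular layout matrix for some `H`. -/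
theorem transversalMinorLayouts_nonsingular_of_le_two (h r : ℕ) (hh : h ≤ 2)
    (u w : Fin r → Finset (Fin h)) (hu : Function.Injective u) (hw : Function.Injective w) :
    ∃ H : Matrix (Fin (h + h)) (Fin (h + h)) ℂ, (Matrix.of fun i j : Fin r =>
      (H.submatrix (fun a : Fin h => if a ∈ u i then Fin.castAdd h a else Fin.natAdd h a)
        (fun c : Fin h => if c ∈ w j then Fin.natAdd h c else Fin.castAdd h c)).det).det ≠ 0 :=
  alive_of_ppDerivable (ppDerivable_layout_of_le_two h r hh u w hu hw)

/-- **The `h ≤ 2` slice of item 19761 `PriorityPeelingCertificatesExist`**: the item's statement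
(route file, verbatim) with the extra hypothesis `h ≤ 2` — every predicate on configurations closed
under clauses (0)–(4) contains every injective TT layout with `h ≤ 2`. Via the bridge
`PPBridge.closed_of_ppDerivable`. -/
theorem priorityPeelingCertificates_of_le_two :
    ∀ P : (nr nc r d : ℕ) → (Fin r → Fin d → Fin nr) → (Fin r → Fin d → Fin nc) → Prop,
    (∀ (nr nc r d : ℕ) (ρ : Fin r → Fin d → Fin nr) (κ : Fin r → Fin d → Fin nc)
      (σ τ : Equiv.Perm (Fin r)) (α β : Fin r → Equiv.Perm (Fin d)),
      P nr nc r d (fun i a => ρ (σ i) (α i a)) (fun j c => κ (τ j) (β j c)) → P nr nc r d ρ κ) →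
    (∀ (nr nc r d : ℕ) (ρ : Fin r → Fin d → Fin nr) (κ : Fin r → Fin d → Fin nc),
      P nc nr r d κ ρ → P nr nc r d ρ κ) →
    (∀ (nr nc d : ℕ) (ρ : Fin 0 → Fin d → Fin nr) (κ : Fin 0 → Fin d → Fin nc), P nr nc 0 d ρ κ) →
    (∀ (nr nc d : ℕ) (ρ : Fin 1 → Fin d → Fin nr) (κ : Fin 1 → Fin d → Fin nc),
      Function.Injective (ρ 0) → Function.Injective (κ 0) → P nr nc 1 d ρ κ) →
    (∀ (nr nc r : ℕ) (ρ : Fin r → Fin 1 → Fin nr) (κ : Fin r → Fin 1 → Fin nc),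
      Function.Injective (fun i => ρ i 0) → Function.Injective (fun j => κ j 0) → P nr nc r 1 ρ κ) →
    (∀ (nr nc d : ℕ) (ρ : Fin 2 → Fin d → Fin nr) (κ : Fin 2 → Fin d → Fin nc),
      Function.Injective (ρ 0) → Function.Injective (ρ 1) → Function.Injective (κ 0) →
      Function.Injective (κ 1) → Set.range (ρ 0) ≠ Set.range (ρ 1) →
      Set.range (κ 0) ≠ Set.range (κ 1) → P nr nc 2 d ρ κ) →
    (∀ (nr nc k m d : ℕ) (ρ : Fin (k + m) → Fin (d + 1) → Fin nr)
      (κ : Fin (k + m) → Fin (d + 1) → Fin nc) (ℓ₀ ℓ₁ : Fin nr) (prio : Fin nc → ℕ)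
      (T : Finset (Fin nc)), ℓ₀ ≠ ℓ₁ → (∀ i : Fin k, ρ (Fin.castAdd m i) 0 = ℓ₀) →
      (∀ i : Fin m, ρ (Fin.natAdd k i) 0 = ℓ₁) →
      (∀ (i : Fin (k + m)) (a : Fin d), ρ i a.succ ≠ ℓ₀ ∧ ρ i a.succ ≠ ℓ₁) →
      (∀ (j : Fin (k + m)) (c : Fin d), prio (κ j c.succ) < prio (κ j 0)) →
      (∀ j : Fin k, κ (Fin.castAdd m j) 0 ∈ T) → (∀ j : Fin m, κ (Fin.natAdd k j) 0 ∉ T) →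
      P nr nc k d (fun i a => ρ (Fin.castAdd m i) a.succ) (fun j c => κ (Fin.castAdd m j) c.succ) →
      P nr nc m d (fun i a => ρ (Fin.natAdd k i) a.succ) (fun j c => κ (Fin.natAdd k j) c.succ) →
      P nr nc (k + m) (d + 1) ρ κ) →
    (∀ (nr nc r d : ℕ) (ρ : Fin r → Fin d → Fin nr) (κ : Fin r → Fin d → Fin nc) (x y : Fin nc),
      x ≠ y → P nr nc r d ρ (fun j c => if κ j c = x ∧ (∀ c' : Fin d, κ j c' ≠ y) then y else κ j c) →
      P nr nc r d ρ κ) →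
    ∀ (h r : ℕ) (u w : Fin r → Finset (Fin h)), h ≤ 2 → Function.Injective u →
      Function.Injective w →
      P (h + h) (h + h) r h (fun i a => if a ∈ u i then Fin.castAdd h a else Fin.natAdd h a)
        (fun j c => if c ∈ w j then Fin.natAdd h c else Fin.castAdd h c) := by
  intro Q h0 h1 h2a h2b h2c _h2d h3 h4 h r u w hh hu hw
  exact PPBridge.closed_of_ppDerivable Q h0 h1 h2a h2b h2c h3 h4
    (ppDerivable_layout_of_le_two h r hh u w hu hw) r (Equiv.refl _)

end Summit.ValiantsHypothesis.ValiantsHypothesis.Theorems.BarrierLever.PPSmall
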